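import Summits.Ventures.PercRepro.C041BlockMapTriangleBridge
/-!
# ROW C-041 — THE ARC-TYPE MODEL IS THE BLOCK MAP OF THE CYCLE: `Θ_{cyc n₁ n₂ n₃} = thetaCyc (2^{n₁+1} − 2)
(2^{n₂+1} − 2) (2^{n₃+1} − 2)` (p6, gen 36; the dictionary of C-041.md §20 (d) / §21 (a), until now paper-level)

Setting of `C041BlockMapTriangleBridge` (the block map of the triangle host is `θ_△`; the statuses of a
three-vertex host decided) and mine-3's `C041CycleArcModel` (`thetaCyc p q s w w′`: the sum over the 27 triples
of arc types — all blue / all red / mixed — of the contribution of the two hanging zones, a mixed arc of `ℓ`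
segments counted `2^ℓ − 2` times; `thetaCyc_eq`: its exact reduction to `θ_△`).  THE DICTIONARY
(`blockMap_cycle_eq_thetaCyc`): the block map of the cycle host with arcs of `n₁ + 1`, `n₂ + 1`, `n₃ + 1`
segments at any inputs `w` is `thetaCyc (2^{n₁+1} − 2) (2^{n₂+1} − 2) (2^{n₃+1} − 2) (w (inl ())) (w (inr ()))`.
Proof: THEOREM (CYCLE EXPANSION) writes the cycle's block map as the combination of the block maps of the
triangle and its seven loopified forms; each of these is computed from the two-exit block map `blockMap_ex2` with
the statuses of the exits decided colouring by colouring (`Conn2`: in a host on three vertices every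
monochromatic path shortens to at most two steps — `reflTransGen_conn2_iff`, the one-step closure a finite check
per host); the sixteen polynomial identities between the coordinates then close coordinate by coordinate
(`ring`).  Hence mine-3's arc-type model of the two-exit cycle (C-041.md §20 (d)) is, in the kernel, the six-vector
of the cycle zone at the six-vectors of the hanging zones (`sixVec_hang_cycle_eq_thetaCyc`, through THEOREM
(BLOCK MAP, `r` EXITS)).
-/

namespace PercRepro

namespace ZoneZ

namespace MultiExit

open ZoneData Pendant Finset TwoExit TreeClosure RelaxedTriangle

/-! ## Paths of at most two steps -/

/-- `s` reaches `v` in at most two steps of the adjacency of colour `c`. -/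
def Conn2 {V E U₁ U₂ : Type} (Z : ZoneData V E U₁ U₂) (c : Bool) (ω : E → Bool) (s v : V) : Prop :=
  s = v ∨ cAdj Z c ω s v ∨ ∃ t, cAdj Z c ω s t ∧ cAdj Z c ω t v

/-- When `Conn2` is closed under one step, it is the reachability. -/
theorem reflTransGen_conn2_iff {V E U₁ U₂ : Type} (Z : ZoneData V E U₁ U₂)
    (hstep : ∀ (c : Bool) (ω : E → Bool) (s x y : V), Conn2 Z c ω s x → cAdj Z c ω x y → Conn2 Z c ω s y)
    (c : Bool) (ω : E → Bool) (s v : V) : Relation.ReflTransGen (cAdj Z c ω) s v ↔ Conn2 Z c ω s v := by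
  constructor
  · intro h
    induction h with
    | refl => exact Or.inl rfl
    | tail _ hstep' ih => exact hstep c ω s _ _ ih hstep'
  · rintro (rfl | h | ⟨t, h1, h2⟩)
    · exact Relation.ReflTransGen.refl
    · exact Relation.ReflTransGen.single h
    · exact (Relation.ReflTransGen.single h1).tail h2

/-- The colourings of a three-edge host, split into their values. -/
theorem hstep_of_split {U₁ U₂ : Type} (Z : ZoneData (Fin 3) (Fin 3) U₁ U₂)
    (key : ∀ (c b₀ b₁ b₂ : Bool) (s x y : Fin 3), Conn2 Z c ![b₀, b₁, b₂] s x →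
      cAdj Z c ![b₀, b₁, b₂] x y → Conn2 Z c ![b₀, b₁, b₂] s y) :
    ∀ (c : Bool) (ω : Fin 3 → Bool) (s x y : Fin 3), Conn2 Z c ω s x → cAdj Z c ω x y → Conn2 Z c ω s y := by
  intro c ω s x y h h'
  rw [fin3_eta ω] at h h' ⊢
  exact key c (ω 0) (ω 1) (ω 2) s x y h h'

/-! ## The statuses of the seven loopified triangles -/

/-- `L0`: one-step closure. -/
theorem hstep_L0 : ∀ (c : Bool) (ω : Fin 3 → Bool) (s x y : Fin 3), Conn2 (loopify tri 0) c ω s x →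
    cAdj (loopify tri 0) c ω x y → Conn2 (loopify tri 0) c ω s y := by
  refine hstep_of_split _ ?_
  intro c b₀ b₁ b₂
  unfold Conn2 cAdj ZoneData.Joins
  cases c <;> cases b₀ <;> cases b₁ <;> cases b₂ <;> decide

/-- `L0`: the statuses (the loop at the anchor, the edges `1 → 2` and `2 → 0`). -/
theorem statuses_L0 (b₀ b₁ b₂ : Bool) :
    ((loopify tri 0).Mg 0 1 ![b₀, b₁, b₂] ↔ (b₁ = false ∧ b₂ = false)) ∧
    ((loopify tri 0).Mg 0 2 ![b₀, b₁, b₂] ↔ b₂ = false) ∧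
    ((loopify tri 0).Mg 1 2 ![b₀, b₁, b₂] ↔ b₁ = false) ∧
    ((loopify tri 0).Rd 0 1 ![b₀, b₁, b₂] ↔ (b₁ = true ∧ b₂ = true)) ∧
    ((loopify tri 0).Rd 0 2 ![b₀, b₁, b₂] ↔ b₂ = true) := by
  simp only [Mg_iff_reflTransGen, Rd_iff_reflTransGen, reflTransGen_conn2_iff _ hstep_L0]
  refine ⟨?_, ?_, ?_, ?_, ?_⟩ <;> (revert b₀ b₁ b₂; unfold Conn2 cAdj ZoneData.Joins; decide)

/-- `L1`: one-step closure. -/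
theorem hstep_L1 : ∀ (c : Bool) (ω : Fin 3 → Bool) (s x y : Fin 3), Conn2 (loopify tri 1) c ω s x →
    cAdj (loopify tri 1) c ω x y → Conn2 (loopify tri 1) c ω s y := by
  refine hstep_of_split _ ?_
  intro c b₀ b₁ b₂
  unfold Conn2 cAdj ZoneData.Joins
  cases c <;> cases b₀ <;> cases b₁ <;> cases b₂ <;> decide

/-- `L1`: the statuses (the loop at the exit `1`, the edges `0 → 1` and `2 → 0`). -/
theorem statuses_L1 (b₀ b₁ b₂ : Bool) :
    ((loopify tri 1).Mg 0 1 ![b₀, b₁, b₂] ↔ b₀ = false) ∧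
    ((loopify tri 1).Mg 0 2 ![b₀, b₁, b₂] ↔ b₂ = false) ∧
    ((loopify tri 1).Mg 1 2 ![b₀, b₁, b₂] ↔ (b₀ = false ∧ b₂ = false)) ∧
    ((loopify tri 1).Rd 0 1 ![b₀, b₁, b₂] ↔ b₀ = true) ∧
    ((loopify tri 1).Rd 0 2 ![b₀, b₁, b₂] ↔ b₂ = true) := by
  simp only [Mg_iff_reflTransGen, Rd_iff_reflTransGen, reflTransGen_conn2_iff _ hstep_L1]
  refine ⟨?_, ?_, ?_, ?_, ?_⟩ <;> (revert b₀ b₁ b₂; unfold Conn2 cAdj ZoneData.Joins; decide)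

/-- `L2`: one-step closure. -/
theorem hstep_L2 : ∀ (c : Bool) (ω : Fin 3 → Bool) (s x y : Fin 3), Conn2 (loopify tri 2) c ω s x →
    cAdj (loopify tri 2) c ω x y → Conn2 (loopify tri 2) c ω s y := by
  refine hstep_of_split _ ?_
  intro c b₀ b₁ b₂
  unfold Conn2 cAdj ZoneData.Joins
  cases c <;> cases b₀ <;> cases b₁ <;> cases b₂ <;> decide

/-- `L2`: the statuses (the loop at the exit `2`, the edges `0 → 1` and `1 → 2`). -/
theorem statuses_L2 (b₀ b₁ b₂ : Bool) :
    ((loopify tri 2).Mg 0 1 ![b₀, b₁, b₂] ↔ b₀ = false) ∧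
    ((loopify tri 2).Mg 0 2 ![b₀, b₁, b₂] ↔ (b₀ = false ∧ b₁ = false)) ∧
    ((loopify tri 2).Mg 1 2 ![b₀, b₁, b₂] ↔ b₁ = false) ∧
    ((loopify tri 2).Rd 0 1 ![b₀, b₁, b₂] ↔ b₀ = true) ∧
    ((loopify tri 2).Rd 0 2 ![b₀, b₁, b₂] ↔ (b₀ = true ∧ b₁ = true)) := by
  simp only [Mg_iff_reflTransGen, Rd_iff_reflTransGen, reflTransGen_conn2_iff _ hstep_L2]
  refine ⟨?_, ?_, ?_, ?_, ?_⟩ <;> (revert b₀ b₁ b₂; unfold Conn2 cAdj ZoneData.Joins; decide)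

/-- `L01`: one-step closure. -/
theorem hstep_L01 : ∀ (c : Bool) (ω : Fin 3 → Bool) (s x y : Fin 3), Conn2 (loopify (loopify tri 1) 0) c ω s x →
    cAdj (loopify (loopify tri 1) 0) c ω x y → Conn2 (loopify (loopify tri 1) 0) c ω s y := by
  refine hstep_of_split _ ?_
  intro c b₀ b₁ b₂
  unfold Conn2 cAdj ZoneData.Joins
  cases c <;> cases b₀ <;> cases b₁ <;> cases b₂ <;> decide

/-- `L01`: the statuses (loops at `0` and `1`, the edge `2 → 0`). -/
theorem statuses_L01 (b₀ b₁ b₂ : Bool) :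
    ((loopify (loopify tri 1) 0).Mg 0 1 ![b₀, b₁, b₂] ↔ False) ∧
    ((loopify (loopify tri 1) 0).Mg 0 2 ![b₀, b₁, b₂] ↔ b₂ = false) ∧
    ((loopify (loopify tri 1) 0).Mg 1 2 ![b₀, b₁, b₂] ↔ False) ∧
    ((loopify (loopify tri 1) 0).Rd 0 1 ![b₀, b₁, b₂] ↔ False) ∧
    ((loopify (loopify tri 1) 0).Rd 0 2 ![b₀, b₁, b₂] ↔ b₂ = true) := by
  simp only [Mg_iff_reflTransGen, Rd_iff_reflTransGen, reflTransGen_conn2_iff _ hstep_L01]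
  refine ⟨?_, ?_, ?_, ?_, ?_⟩ <;> (revert b₀ b₁ b₂; unfold Conn2 cAdj ZoneData.Joins; decide)

/-- `L02`: one-step closure. -/
theorem hstep_L02 : ∀ (c : Bool) (ω : Fin 3 → Bool) (s x y : Fin 3), Conn2 (loopify (loopify tri 2) 0) c ω s x →
    cAdj (loopify (loopify tri 2) 0) c ω x y → Conn2 (loopify (loopify tri 2) 0) c ω s y := by
  refine hstep_of_split _ ?_
  intro c b₀ b₁ b₂
  unfold Conn2 cAdj ZoneData.Joins
  cases c <;> cases b₀ <;> cases b₁ <;> cases b₂ <;> decide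

/-- `L02`: the statuses (loops at `0` and `2`, the edge `1 → 2`). -/
theorem statuses_L02 (b₀ b₁ b₂ : Bool) :
    ((loopify (loopify tri 2) 0).Mg 0 1 ![b₀, b₁, b₂] ↔ False) ∧
    ((loopify (loopify tri 2) 0).Mg 0 2 ![b₀, b₁, b₂] ↔ False) ∧
    ((loopify (loopify tri 2) 0).Mg 1 2 ![b₀, b₁, b₂] ↔ b₁ = false) ∧
    ((loopify (loopify tri 2) 0).Rd 0 1 ![b₀, b₁, b₂] ↔ False) ∧
    ((loopify (loopify tri 2) 0).Rd 0 2 ![b₀, b₁, b₂] ↔ False) := by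
  simp only [Mg_iff_reflTransGen, Rd_iff_reflTransGen, reflTransGen_conn2_iff _ hstep_L02]
  refine ⟨?_, ?_, ?_, ?_, ?_⟩ <;> (revert b₀ b₁ b₂; unfold Conn2 cAdj ZoneData.Joins; decide)

/-- `L12`: one-step closure. -/
theorem hstep_L12 : ∀ (c : Bool) (ω : Fin 3 → Bool) (s x y : Fin 3), Conn2 (loopify (loopify tri 2) 1) c ω s x →
    cAdj (loopify (loopify tri 2) 1) c ω x y → Conn2 (loopify (loopify tri 2) 1) c ω s y := by
  refine hstep_of_split _ ?_
  intro c b₀ b₁ b₂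
  unfold Conn2 cAdj ZoneData.Joins
  cases c <;> cases b₀ <;> cases b₁ <;> cases b₂ <;> decide

/-- `L12`: the statuses (loops at `1` and `2`, the edge `0 → 1`). -/
theorem statuses_L12 (b₀ b₁ b₂ : Bool) :
    ((loopify (loopify tri 2) 1).Mg 0 1 ![b₀, b₁, b₂] ↔ b₀ = false) ∧
    ((loopify (loopify tri 2) 1).Mg 0 2 ![b₀, b₁, b₂] ↔ False) ∧
    ((loopify (loopify tri 2) 1).Mg 1 2 ![b₀, b₁, b₂] ↔ False) ∧
    ((loopify (loopify tri 2) 1).Rd 0 1 ![b₀, b₁, b₂] ↔ b₀ = true) ∧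
    ((loopify (loopify tri 2) 1).Rd 0 2 ![b₀, b₁, b₂] ↔ False) := by
  simp only [Mg_iff_reflTransGen, Rd_iff_reflTransGen, reflTransGen_conn2_iff _ hstep_L12]
  refine ⟨?_, ?_, ?_, ?_, ?_⟩ <;> (revert b₀ b₁ b₂; unfold Conn2 cAdj ZoneData.Joins; decide)

/-- `L012`: one-step closure. -/
theorem hstep_L012 : ∀ (c : Bool) (ω : Fin 3 → Bool) (s x y : Fin 3),
    Conn2 (loopify (loopify (loopify tri 2) 1) 0) c ω s x → cAdj (loopify (loopify (loopify tri 2) 1) 0) c ω x y →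
    Conn2 (loopify (loopify (loopify tri 2) 1) 0) c ω s y := by
  refine hstep_of_split _ ?_
  intro c b₀ b₁ b₂
  unfold Conn2 cAdj ZoneData.Joins
  cases c <;> cases b₀ <;> cases b₁ <;> cases b₂ <;> decide

/-- `L012`: the statuses (three loops, no edge). -/
theorem statuses_L012 (b₀ b₁ b₂ : Bool) :
    ((loopify (loopify (loopify tri 2) 1) 0).Mg 0 1 ![b₀, b₁, b₂] ↔ False) ∧
    ((loopify (loopify (loopify tri 2) 1) 0).Mg 0 2 ![b₀, b₁, b₂] ↔ False) ∧
    ((loopify (loopify (loopify tri 2) 1) 0).Mg 1 2 ![b₀, b₁, b₂] ↔ False) ∧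
    ((loopify (loopify (loopify tri 2) 1) 0).Rd 0 1 ![b₀, b₁, b₂] ↔ False) ∧
    ((loopify (loopify (loopify tri 2) 1) 0).Rd 0 2 ![b₀, b₁, b₂] ↔ False) := by
  simp only [Mg_iff_reflTransGen, Rd_iff_reflTransGen, reflTransGen_conn2_iff _ hstep_L012]
  refine ⟨?_, ?_, ?_, ?_, ?_⟩ <;> (revert b₀ b₁ b₂; unfold Conn2 cAdj ZoneData.Joins; decide)


/-! ## The block maps of the seven loopified triangles -/

/-- `L0` (the path `0 – 2 – 1` with a loop at the anchor): `2·ℓψ(w′·ℓψ(w))`. -/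
theorem blockMap_L0 (w : Unit ⊕ Unit → Vec6) :
    blockMap (loopify tri 0) triExit 0 w = (2 : ℝ) • ellv (w (Sum.inr ()) * ellv (w (Sum.inl ()))) := by
  rw [← blockMap_reindex _ triExit 0 boolEquivSum w, triExit_comp, blockMap_ex2,
    Fintype.sum_equiv fin3Equiv _ (fun p => contrib ((w ∘ boolEquivSum) false) ((w ∘ boolEquivSum) true)
      ((loopify tri 0).Mg 0 1 (fin3Equiv.symm p)) ((loopify tri 0).Rd 0 1 (fin3Equiv.symm p))
      ((loopify tri 0).Mg 0 2 (fin3Equiv.symm p)) ((loopify tri 0).Rd 0 2 (fin3Equiv.symm p))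
      ((loopify tri 0).Mg 1 2 (fin3Equiv.symm p))) (fun ω => by rw [Equiv.symm_apply_apply])]
  simp only [Fintype.sum_prod_type, Fintype.sum_bool, fin3Equiv_symm_apply, statuses_L0, Bool.true_eq_false,
    Bool.false_eq_true, and_false, and_true]
  simp only [contrib, exitOf, if_true, if_false, Function.comp_apply, boolEquivSum_false, boolEquivSum_true]
  ext i
  simp only [Pi.add_apply, Pi.mul_apply, Pi.smul_apply, smul_eq_mul, thB, thR, ellv, ell, nAdm,
    kInv]
  fin_cases i <;> simp <;> ring

/-- `L1` (the path `1 – 0 – 2` with the anchor in the middle and a loop at `1`): `2·ℓψ(w)·ℓψ(w′)`. -/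
theorem blockMap_L1 (w : Unit ⊕ Unit → Vec6) :
    blockMap (loopify tri 1) triExit 0 w = (2 : ℝ) • (ellv (w (Sum.inl ())) * ellv (w (Sum.inr ()))) := by
  rw [← blockMap_reindex _ triExit 0 boolEquivSum w, triExit_comp, blockMap_ex2,
    Fintype.sum_equiv fin3Equiv _ (fun p => contrib ((w ∘ boolEquivSum) false) ((w ∘ boolEquivSum) true)
      ((loopify tri 1).Mg 0 1 (fin3Equiv.symm p)) ((loopify tri 1).Rd 0 1 (fin3Equiv.symm p))
      ((loopify tri 1).Mg 0 2 (fin3Equiv.symm p)) ((loopify tri 1).Rd 0 2 (fin3Equiv.symm p))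
      ((loopify tri 1).Mg 1 2 (fin3Equiv.symm p))) (fun ω => by rw [Equiv.symm_apply_apply])]
  simp only [Fintype.sum_prod_type, Fintype.sum_bool, fin3Equiv_symm_apply, statuses_L1, Bool.true_eq_false,
    Bool.false_eq_true, and_false, and_true]
  simp only [contrib, exitOf, if_true, if_false, Function.comp_apply, boolEquivSum_false, boolEquivSum_true]
  ext i
  simp only [Pi.add_apply, Pi.mul_apply, Pi.smul_apply, smul_eq_mul, thB, thR, ellv, ell, nAdm,
    kInv]
  fin_cases i <;> simp <;> ring

/-- `L2` (the path `0 – 1 – 2` with a loop at `2`): `2·ℓψ(w·ℓψ(w′))`. -/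
theorem blockMap_L2 (w : Unit ⊕ Unit → Vec6) :
    blockMap (loopify tri 2) triExit 0 w = (2 : ℝ) • ellv (w (Sum.inl ()) * ellv (w (Sum.inr ()))) := by
  rw [← blockMap_reindex _ triExit 0 boolEquivSum w, triExit_comp, blockMap_ex2,
    Fintype.sum_equiv fin3Equiv _ (fun p => contrib ((w ∘ boolEquivSum) false) ((w ∘ boolEquivSum) true)
      ((loopify tri 2).Mg 0 1 (fin3Equiv.symm p)) ((loopify tri 2).Rd 0 1 (fin3Equiv.symm p))
      ((loopify tri 2).Mg 0 2 (fin3Equiv.symm p)) ((loopify tri 2).Rd 0 2 (fin3Equiv.symm p))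
      ((loopify tri 2).Mg 1 2 (fin3Equiv.symm p))) (fun ω => by rw [Equiv.symm_apply_apply])]
  simp only [Fintype.sum_prod_type, Fintype.sum_bool, fin3Equiv_symm_apply, statuses_L2, Bool.true_eq_false,
    Bool.false_eq_true, and_false, and_true]
  simp only [contrib, exitOf, if_true, if_false, Function.comp_apply, boolEquivSum_false, boolEquivSum_true]
  ext i
  simp only [Pi.add_apply, Pi.mul_apply, Pi.smul_apply, smul_eq_mul, thB, thR, ellv, ell, nAdm,
    kInv]
  fin_cases i <;> simp <;> ring

/-- `L01` (the pendant exit `2`, the isolated exit `1`, loops at `0` and `1`): `4·n(w)·ℓψ(w′)`. -/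
theorem blockMap_L01 (w : Unit ⊕ Unit → Vec6) :
    blockMap (loopify (loopify tri 1) 0) triExit 0 w = (4 * nAdm (w (Sum.inl ()))) • ellv (w (Sum.inr ())) := by
  rw [← blockMap_reindex _ triExit 0 boolEquivSum w, triExit_comp, blockMap_ex2,
    Fintype.sum_equiv fin3Equiv _ (fun p => contrib ((w ∘ boolEquivSum) false) ((w ∘ boolEquivSum) true)
      ((loopify (loopify tri 1) 0).Mg 0 1 (fin3Equiv.symm p)) ((loopify (loopify tri 1) 0).Rd 0 1 (fin3Equiv.symm p))
      ((loopify (loopify tri 1) 0).Mg 0 2 (fin3Equiv.symm p)) ((loopify (loopify tri 1) 0).Rd 0 2 (fin3Equiv.symm p))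
      ((loopify (loopify tri 1) 0).Mg 1 2 (fin3Equiv.symm p))) (fun ω => by rw [Equiv.symm_apply_apply])]
  simp only [Fintype.sum_prod_type, Fintype.sum_bool, fin3Equiv_symm_apply, statuses_L01, Bool.true_eq_false,
    Bool.false_eq_true]
  simp only [contrib, exitOf, if_true, if_false, Function.comp_apply, boolEquivSum_false, boolEquivSum_true]
  ext i
  simp only [Pi.add_apply, Pi.mul_apply, Pi.smul_apply, smul_eq_mul, thB, thR, ellv, ell, nAdm,
    kInv]
  fin_cases i <;> simp <;> ring

/-- `L02` (the isolated anchor, the exits joined by an edge, loops at `0` and `2`): `4·(n(w·w′) + n(w)·n(w′))·𝟙`. -/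
theorem blockMap_L02 (w : Unit ⊕ Unit → Vec6) :
    blockMap (loopify (loopify tri 2) 0) triExit 0 w = (4 * (nAdm (w (Sum.inl ()) * w (Sum.inr ())) + nAdm (w (Sum.inl ())) * nAdm (w (Sum.inr ())))) • (1 : Vec6) := by
  rw [← blockMap_reindex _ triExit 0 boolEquivSum w, triExit_comp, blockMap_ex2,
    Fintype.sum_equiv fin3Equiv _ (fun p => contrib ((w ∘ boolEquivSum) false) ((w ∘ boolEquivSum) true)
      ((loopify (loopify tri 2) 0).Mg 0 1 (fin3Equiv.symm p)) ((loopify (loopify tri 2) 0).Rd 0 1 (fin3Equiv.symm p))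
      ((loopify (loopify tri 2) 0).Mg 0 2 (fin3Equiv.symm p)) ((loopify (loopify tri 2) 0).Rd 0 2 (fin3Equiv.symm p))
      ((loopify (loopify tri 2) 0).Mg 1 2 (fin3Equiv.symm p))) (fun ω => by rw [Equiv.symm_apply_apply])]
  simp only [Fintype.sum_prod_type, Fintype.sum_bool, fin3Equiv_symm_apply, statuses_L02, Bool.true_eq_false,
]
  simp only [contrib, exitOf, if_true, if_false, Function.comp_apply, boolEquivSum_false, boolEquivSum_true]
  ext i
  simp only [Pi.add_apply, Pi.mul_apply, Pi.smul_apply, Pi.one_apply, smul_eq_mul, thB, thR, nAdm,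
    kInv]
  fin_cases i <;> simp <;> ring

/-- `L12` (the pendant exit `1`, the isolated exit `2`, loops at `1` and `2`): `4·n(w′)·ℓψ(w)`. -/
theorem blockMap_L12 (w : Unit ⊕ Unit → Vec6) :
    blockMap (loopify (loopify tri 2) 1) triExit 0 w = (4 * nAdm (w (Sum.inr ()))) • ellv (w (Sum.inl ())) := by
  rw [← blockMap_reindex _ triExit 0 boolEquivSum w, triExit_comp, blockMap_ex2,
    Fintype.sum_equiv fin3Equiv _ (fun p => contrib ((w ∘ boolEquivSum) false) ((w ∘ boolEquivSum) true)
      ((loopify (loopify tri 2) 1).Mg 0 1 (fin3Equiv.symm p)) ((loopify (loopify tri 2) 1).Rd 0 1 (fin3Equiv.symm p))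
      ((loopify (loopify tri 2) 1).Mg 0 2 (fin3Equiv.symm p)) ((loopify (loopify tri 2) 1).Rd 0 2 (fin3Equiv.symm p))
      ((loopify (loopify tri 2) 1).Mg 1 2 (fin3Equiv.symm p))) (fun ω => by rw [Equiv.symm_apply_apply])]
  simp only [Fintype.sum_prod_type, Fintype.sum_bool, fin3Equiv_symm_apply, statuses_L12, Bool.true_eq_false,
    Bool.false_eq_true]
  simp only [contrib, exitOf, if_true, if_false, Function.comp_apply, boolEquivSum_false, boolEquivSum_true]
  ext i
  simp only [Pi.add_apply, Pi.mul_apply, Pi.smul_apply, smul_eq_mul, thB, thR, ellv, ell, nAdm,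
    kInv]
  fin_cases i <;> simp <;> ring

/-- `L012` (three isolated vertices with loops): `8·n(w)·n(w′)·𝟙`. -/
theorem blockMap_L012 (w : Unit ⊕ Unit → Vec6) :
    blockMap (loopify (loopify (loopify tri 2) 1) 0) triExit 0 w = (8 * (nAdm (w (Sum.inl ())) * nAdm (w (Sum.inr ())))) • (1 : Vec6) := by
  rw [← blockMap_reindex _ triExit 0 boolEquivSum w, triExit_comp, blockMap_ex2,
    Fintype.sum_equiv fin3Equiv _ (fun p => contrib ((w ∘ boolEquivSum) false) ((w ∘ boolEquivSum) true)
      ((loopify (loopify (loopify tri 2) 1) 0).Mg 0 1 (fin3Equiv.symm p)) ((loopify (loopify (loopify tri 2) 1) 0).Rd 0 1 (fin3Equiv.symm p))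
      ((loopify (loopify (loopify tri 2) 1) 0).Mg 0 2 (fin3Equiv.symm p)) ((loopify (loopify (loopify tri 2) 1) 0).Rd 0 2 (fin3Equiv.symm p))
      ((loopify (loopify (loopify tri 2) 1) 0).Mg 1 2 (fin3Equiv.symm p))) (fun ω => by rw [Equiv.symm_apply_apply])]
  simp only [Fintype.sum_prod_type, Fintype.sum_bool, fin3Equiv_symm_apply, statuses_L012, 
]
  simp only [contrib, exitOf, if_false, Function.comp_apply, boolEquivSum_false, boolEquivSum_true]
  ext i
  simp only [Pi.add_apply, Pi.mul_apply, Pi.smul_apply, Pi.one_apply, smul_eq_mul, thB, thR, nAdm,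
    kInv]
  fin_cases i <;> simp <;> ring

/-! ## THE DICTIONARY -/

/-- **THE ARC-TYPE MODEL IS THE BLOCK MAP OF THE CYCLE**: the block map of the cycle host with arcs of
`n₁ + 1`, `n₂ + 1`, `n₃ + 1` segments at any inputs is mine-3's `thetaCyc` with the mixed-arc multiplicities
`2^{nᵢ+1} − 2`. -/
theorem blockMap_cycle_eq_thetaCyc (n₁ n₂ n₃ : ℕ) (w : Unit ⊕ Unit → Vec6) :
    blockMap (cyc n₁ n₂ n₃) (cycExit n₁ n₂ n₃) (cycAnchor n₁ n₂ n₃) w =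
      thetaCyc ((2 : ℝ) ^ (n₁ + 1) - 2) ((2 : ℝ) ^ (n₂ + 1) - 2) ((2 : ℝ) ^ (n₃ + 1) - 2)
        (w (Sum.inl ())) (w (Sum.inr ())) := by
  rw [blockMap_cycle, blockMap_tri, blockMap_L0, blockMap_L1, blockMap_L2, blockMap_L01, blockMap_L02,
    blockMap_L12, blockMap_L012, thetaCyc_eq]
  ext i
  simp only [Pi.add_apply, Pi.mul_apply, Pi.smul_apply, Pi.one_apply, smul_eq_mul, ellv, ell, nAdm, pow_succ]
  fin_cases i <;> simp <;> ring

/-- **The zone form of the dictionary**: the six-vector of two zones hung at the exits of the cycle is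
`thetaCyc` of their six-vectors. -/
theorem sixVec_hang_cycle_eq_thetaCyc (n₁ n₂ n₃ : ℕ) {V E T₁ T₂ : Unit ⊕ Unit → Type}
    (Z : (k : Unit ⊕ Unit) → ZoneData (V k) (E k) (T₁ k) (T₂ k)) (a : (k : Unit ⊕ Unit) → V k)
    [∀ k, Fintype (E k)] [∀ k, DecidableEq (E k)] [∀ k, Fintype (T₁ k)] [∀ k, DecidableEq (T₁ k)]
    [∀ k, Fintype (T₂ k)] [∀ k, DecidableEq (T₂ k)] :
    (hang (cyc n₁ n₂ n₃) (cycExit n₁ n₂ n₃) Z a).sixVec (Sum.inl (cycAnchor n₁ n₂ n₃)) =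
      thetaCyc ((2 : ℝ) ^ (n₁ + 1) - 2) ((2 : ℝ) ^ (n₂ + 1) - 2) ((2 : ℝ) ^ (n₃ + 1) - 2)
        ((Z (Sum.inl ())).sixVec (a (Sum.inl ()))) ((Z (Sum.inr ())).sixVec (a (Sum.inr ()))) := by
  rw [sixVec_hang_eq_blockMap, blockMap_cycle_eq_thetaCyc]

end MultiExit

end ZoneZ

end PercRepro
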